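import Summits.BirchSwinnertonDyer.BirchSwinnertonDyer.Theorems.UniversalToricDescentTwinSplitIMCAtThreeGoodOrdOfYanZhu
import Summits.BirchSwinnertonDyer.BirchSwinnertonDyer.Theorems.UniversalToricDescentTwinSplitIMCAtThreeEveryFrame
import Summits.BirchSwinnertonDyer.BirchSwinnertonDyer.Theorems.UniversalToricDescentTwinSplitIMCAtThreeFrameGood
import Summits.BirchSwinnertonDyer.BirchSwinnertonDyer.Theorems.BiquadraticEisensteinDescentEisensteinDivisibilityCMInertBadStubE3
import HarnessLib

/-!
# Route `UniversalToricDescent`, crux #3 `TwinSplitIMCAtThree` (item stmt-BirchSwinnertonDyer-20214) ON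
# BUCKET A, INTEGRALLY AND WITHOUT A FULL-IMAGE HYPOTHESIS: for every twin GOOD ORDINARY at `3` with
# `ρ̄₃` onto over `ℚ` and every Heegner `K` with `3` split and `D_K` odd, conjuncts (i) ∧ (ii) hold
# VERBATIM at every frame — by name three refereed theorems (BCS 2025 Thm. 4.2.1 (b) = Howard + BCK;
# Yan–Zhu 2026 Thm. 5.7 (1), rational clause; BCS 2025 Prop. 4.2.2 = Hsieh's `μ = 0`) and the tree's
# integral cross-period rigidity + prime avoidance by `3` in `R₀⟦T⟧`

Seat `bsd-wall-utd-p2` (D-0131 (3) MIDDLE tier; memo `HOME/bsd-wall/bsd-wall-utd-p2/SUPSET-AT3-v3.md`).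
Kernel-checked, sorry-free, CONDITIONAL on THREE named refereed facts taken as hypotheses:
`h421` (`BurungaleCastellaSkinner2025.thm421b_…`: integral `⊇`, i.e. `𝓛 ∈ Ch·Λ^{ur}`, under (sur) over
`ℚ`, odd `p`), `h57` (`YanZhu2026.thm57_…`: the RATIONAL clause only — `3^{k′}·Ch·Λ^{ur} ⊆ (𝓛)` —, `p > 2`),
`h422` (`BurungaleCastellaSkinner2025.prop422_…`: a frame with `μ(𝓛) = 0`, `p > 2`). The three facts
speak of three a-priori DIFFERENT frames; the tree's integral cross-period rigidity
(`span_singleton_eq_of_isBDPLFunction`, p536114) identifies their ideals, and prime avoidance by the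
prime element `3 ∈ R₀⟦T⟧` upgrades "`⊆` up to `3^{k′}`" + "`μ = 0`" to `⊆`. NO hypothesis on the
`3`-adic image beyond `ρ̄₃` onto over `ℚ` (compare `twinSplit_instance_of_goodOrd_of_fullImage`).

* `not_C_dvd_of_isUnit_coeff` — a series with a unit coefficient is not divisible by `p` (any prime);
  the prime avoidance `p ∤ L ∧ p^m·I ⊆ (L) ⟹ I ⊆ (L)` in `R₀⟦T⟧` is the tree's
  `BiquadraticEisensteinDescentEisensteinDivisibilityCMInertBadStubE3.stub_E3` (route BED, reused).
* **`twinSplit_instance_of_goodOrd`** — conjuncts (i) ∧ (ii) of `TwinSplitIMCAtThree` VERBATIM at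
  `(W′, N′, K, Dt′, κ, γ, 𝔭, 𝔭′, ι′)` for `GoodOrd W′ 3`, `ρ̄_{W′,3}` onto, `K` imaginary quadratic with the
  Heegner hypothesis for `N′` and `Odd (discr K)`, `κ` anticyclotomic, `3 = 𝔭𝔭′`, `ι′` inducing `𝔭`.
  The ONLY hypotheses beyond the crux's own binders are `GoodOrd W′ 3` (the crux allows any semistable
  twin; the kernel chooses the twin) and `Odd (discr K)` (the kernel chooses `K`; free via `2 ∣ M` in
  Friedberg–Hoffstein, `odd_discr_of_satisfiesHeegnerHypothesis_of_two_dvd`).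

PARTITION (census TWIN-PRINT-AT3-v1 §2): bucket A = **745 of the 2 023** twin-having classes (36.8 %)
have a good-ordinary twin — on every such instance crux #3 is now a conditional-result on three REFEREED
named facts, nothing else; this CORRECTS TWIN-PRINT-AT3-v1 §1/§3 («⊆-half not in print at p = 3»):
Yan–Zhu, J. Algebra 693 (2026) Thm. 5.7 print the BDP main conjecture at `p > 2` ("Their [BCS's]
results don't cover ours, nor do ours cover theirs", Remark 1.3). Buckets B (675, only `3 ∥ N′` twins)
and C (603, only supersingular twins): untouched by print at `p = 3`. Beyond-print BSD theorem: NO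
(three printed theorems wired; the typer's provenance flag `YZ26@3-BF-ERL-Ohta` on Yan–Zhu's proof-level
inputs at `p = 3` and BCK21's standing `p > 3` are referee-desk matters). `--supports stmt-BirchSwinnertonDyer-20214`.

References: [BurungaleCastellaSkinner2025] Thm. 4.2.1 (b), Prop. 4.2.2 (arXiv:2405.00270v2 pp. 8–9);
[YanZhu2024MainConjNonCM] Thm. 5.7 (1), Rem. 1.3 (arXiv:2412.20078; J. Algebra 693 (2026));
[Hsieh2014] Thm. B; [Castella2018] Thm. 3.1.
-/

noncomputable section

open scoped Classical Topology

set_option linter.dupNamespace false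
set_option autoImplicit false

namespace Summit.BirchSwinnertonDyer.BirchSwinnertonDyer.Theorems.UniversalToricDescentTwinSplit

open Filter PowerSeries WeierstrassCurve NumberField IsDedekindDomain Field
  Literature.NumberTheory.EllipticCurves
  Literature.NumberTheory.EllipticCurves.ModularForms
  Literature.NumberTheory.EllipticCurves.Rank1Residual
  Literature.NumberTheory.GaloisRepresentations
  Summit.BirchSwinnertonDyer.Rank1Residual
  Summit.BirchSwinnertonDyer.Rank1Residual.X11b
  Summit.BirchSwinnertonDyer.Rank1Residual.X11b.Halves
  Summit.BirchSwinnertonDyer.BirchSwinnertonDyer.Theorems.SchneiderFree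
  Summit.BirchSwinnertonDyer.Rank1Residual.X2.HidaLimitAlgebra

/-! ## §1 The algebra: `μ = 0 ⟹ p ∤ L` -/

section Algebra

variable {p : ℕ} [hp : Fact p.Prime]

/-- **A series with a unit coefficient is not divisible by `p`** (`μ = 0 ⟹ p ∤ L`): every coefficient of
`C p · M` lies in `p R₀`, and `p` is not a unit of `R₀`. [folklore] -/
theorem not_C_dvd_of_isUnit_coeff {L : UnrSeries p} (hL : ∃ i : ℕ, IsUnit (PowerSeries.coeff i L)) :
    ¬ (C ((p : ℕ) : unrIntegers p) : UnrSeries p) ∣ L := by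
  rintro ⟨M, rfl⟩
  obtain ⟨i, hi⟩ := hL
  rw [PowerSeries.coeff_C_mul] at hi
  exact irreducible_natCast_p.not_isUnit (isUnit_of_mul_isUnit_left hi)

end Algebra

/-! ## §2 Crux #3 on bucket A, integrally, with no full-image hypothesis -/

/-- **Crux #3 `TwinSplitIMCAtThree` holds VERBATIM — (i) a BDP frame exists, (ii) EVERY frame `L′` has
`Ch_Λ(X_ac(W′_K) strict at 𝔭′)·R₀⟦T⟧ = (L′)` — at every instance whose twin `W′` is GOOD ORDINARY at `3`
with `ρ̄_{W′,3}` onto over `ℚ`, for every imaginary quadratic `K` with the Heegner hypothesis for `N′`,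
`3 = 𝔭𝔭′` split and `D_K` ODD.** Proof: the `μ = 0` frame `L₃` of `h422` (`exists_frame_mu_eq_zero_of_good`)
has `3 ∤ L₃`; at THAT frame `(L₃) ⊆ Ch·R₀⟦T⟧` (`forall_frame_supset_of_goodOrd`, from `h421` via
cross-period rigidity) and `3^{k′}·Ch·R₀⟦T⟧ ⊆ (L₃)` (`forall_frame_charIdeal_eq_rat_of_goodOrd`, from `h57`
via cross-period rigidity), so prime avoidance gives `Ch·R₀⟦T⟧ = (L₃)`, and `forall_frame_eq_span_of_exists`
moves the identity to every frame. CONDITIONAL on the three named facts `h421`, `h57`, `h422`.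
[cite: BurungaleCastellaSkinner2025, Thm. 4.2.1 (b) and Prop. 4.2.2 (§4.2, pp. 8–9 of arXiv:2405.00270v2)]
[cite: YanZhu2024MainConjNonCM, Thm. 5.7 (1) (§5.2, arXiv:2412.20078v4 l.1217–1227; J. Algebra 693 (2026))] -/
theorem twinSplit_instance_of_goodOrd
    (h421 : BurungaleCastellaSkinner2025.thm421b_exists_isBDPLFunction_isTorsion_mem_charIdeal)
    (h57 : YanZhu2026.thm57_isTorsion_charIdealXGr_eq_bdpLFunction)
    (h422 : BurungaleCastellaSkinner2025.prop422_exists_isBDPLFunction_mu_eq_zero)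
    (W' : WeierstrassCurve ℚ) [W'.IsElliptic] [W'.IsGloballyMinimal] (N' : ℕ) [NeZero N']
    (K : Type) [Field K] [NumberField K] (Dt' : ModularParametrizationData W' N')
    (hord : GoodOrd W' 3) (hsurj : W'.HasSurjectiveModNGaloisRep 3)
    (hK : IsImaginaryQuadratic K) (hH : SatisfiesHeegnerHypothesis N' K)
    (hodd : Odd (NumberField.discr K))
    (κ : ZpExtension K 3) (hκ : κ.IsAnticyclotomic) (γ : absoluteGaloisGroup K)
    [hγ : Fact (κ.IsTopGenerator γ)]
    (𝔭 : HeightOneSpectrum (𝓞 K)) (h𝔭 : ((3 : ℕ) : 𝓞 K) ∈ 𝔭.asIdeal)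
    (he : 𝔭.asIdeal.ramificationIdx (𝓞 ℚ) = 1) (hf : 𝔭.asIdeal.inertiaDeg (𝓞 ℚ) = 1)
    (𝔭' : HeightOneSpectrum (𝓞 K)) (h𝔭' : ((3 : ℕ) : 𝓞 K) ∈ 𝔭'.asIdeal) (hne : 𝔭' ≠ 𝔭)
    (ι' : PadicAlgCl 3 ≃+* ℂ) (hι' : BranchInducesPrime 3 ι' 𝔭) :
    (∃ (ΩK : ℂ) (Ωp : ℂ_[3]) (L' : UnrSeries 3), ΩK ≠ 0 ∧ Ωp ≠ 0 ∧
        IsBDPLFunction ι' 𝔭 κ γ Dt'.f ΩK Ωp L') ∧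
      (∀ (ΩK : ℂ) (Ωp : ℂ_[3]) (L' : UnrSeries 3), ΩK ≠ 0 → Ωp ≠ 0 →
        IsBDPLFunction ι' 𝔭 κ γ Dt'.f ΩK Ωp L' →
        (AcSelmer.XAc.charIdeal (W'.baseChange K) 3 κ 𝔭' ∅ γ).map (PowerSeries.map (toUnr 3)) =
          Ideal.span {L'}) := by
  have hd3 : NumberField.discr K ≠ -3 := discr_ne_neg_three_of_degreeOne hK h𝔭 he hf
  -- the `μ = 0` frame
  obtain ⟨ΩK₃, Ωp₃, L₃, hΩK₃, hL₃, hμ⟩ := exists_frame_mu_eq_zero_of_good h422 W' N' K Dt' hord.1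
    hsurj hK hH hodd hd3 κ hκ γ 𝔭 h𝔭 he hf ι' hι'
  have hΩp₃ : ((Ωp₃ : unrIntegers 3) : ℂ_[3]) ≠ 0 := by
    intro h0
    have h1 := norm_coe_units_unrIntegers 3 Ωp₃
    rw [h0, norm_zero] at h1
    exact zero_ne_one h1
  have hndvd : ¬ (C ((3 : ℕ) : unrIntegers 3) : UnrSeries 3) ∣ L₃ := not_C_dvd_of_isUnit_coeff hμ
  set I := (AcSelmer.XAc.charIdeal (W'.baseChange K) 3 κ 𝔭' ∅ γ).map (PowerSeries.map (toUnr 3))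
    with hIdef
  -- `⊇` at that frame (BCS 4.2.1 (b) moved across periods)
  have hsup : Ideal.span {L₃} ≤ I := forall_frame_supset_of_goodOrd h421 W' N' K Dt' hord hsurj hK hH
    hodd κ hκ γ 𝔭 h𝔭 he hf 𝔭' h𝔭' hne ι' hι' ΩK₃ _ L₃ hΩK₃ hΩp₃ hL₃
  -- `⊆` up to `3^{k'}` at that frame (Yan–Zhu 5.7 (1), rational clause, moved across periods)
  obtain ⟨-, k', hk'⟩ := (forall_frame_charIdeal_eq_rat_of_goodOrd h57 W' N' K Dt' hord hsurj hK hH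
    hodd κ hκ γ 𝔭 h𝔭 he hf 𝔭' h𝔭' hne ι' hι').2 ΩK₃ _ L₃ hΩK₃ hΩp₃ hL₃
  -- prime avoidance: `⊆` integrally
  have hsub : I ≤ Ideal.span {L₃} :=
    BiquadraticEisensteinDescentEisensteinDivisibilityCMInertBadStubE3.stub_E3 3 I L₃ k' hndvd
      (fun G hG ↦ by rw [← map_pow]; exact hk' G hG)
  have heq : I = Ideal.span {L₃} := le_antisymm hsub hsup
  exact ⟨⟨ΩK₃, _, L₃, hΩK₃, hΩp₃, hL₃⟩,
    forall_frame_eq_span_of_exists hK hκ hγ.out ⟨ΩK₃, _, L₃, hΩK₃, hΩp₃, hL₃, heq⟩⟩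

/-- **… and `X_ac(W′_K)` strict at `𝔭′` is `Λ`-torsion** on the same instances (from `h421`'s frame;
recorded separately because the crux's clause (ii) does not state it while every consumer of a
characteristic ideal wants it). CONDITIONAL on `h421`.
[cite: BurungaleCastellaSkinner2025, Thm. 4.2.1 (b) (§4.2, p. 8 of arXiv:2405.00270v2)] -/
theorem xac_isTorsion_of_goodOrd
    (h421 : BurungaleCastellaSkinner2025.thm421b_exists_isBDPLFunction_isTorsion_mem_charIdeal)
    (W' : WeierstrassCurve ℚ) [W'.IsElliptic] [W'.IsGloballyMinimal] (N' : ℕ) [NeZero N']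
    (K : Type) [Field K] [NumberField K] (Dt' : ModularParametrizationData W' N')
    (hord : GoodOrd W' 3) (hsurj : W'.HasSurjectiveModNGaloisRep 3)
    (hK : IsImaginaryQuadratic K) (hH : SatisfiesHeegnerHypothesis N' K)
    (hodd : Odd (NumberField.discr K))
    (κ : ZpExtension K 3) (hκ : κ.IsAnticyclotomic) (γ : absoluteGaloisGroup K)
    [Fact (κ.IsTopGenerator γ)]
    (𝔭 : HeightOneSpectrum (𝓞 K)) (h𝔭 : ((3 : ℕ) : 𝓞 K) ∈ 𝔭.asIdeal)
    (he : 𝔭.asIdeal.ramificationIdx (𝓞 ℚ) = 1) (hf : 𝔭.asIdeal.inertiaDeg (𝓞 ℚ) = 1)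
    (𝔭' : HeightOneSpectrum (𝓞 K)) (h𝔭' : ((3 : ℕ) : 𝓞 K) ∈ 𝔭'.asIdeal) (hne : 𝔭' ≠ 𝔭)
    (ι' : PadicAlgCl 3 ≃+* ℂ) (hι' : BranchInducesPrime 3 ι' 𝔭) :
    Module.IsTorsion (IwasawaAlgebra 3) (AcSelmer.XAc (W'.baseChange K) 3 κ 𝔭' ∅ γ) := by
  have hd3 : NumberField.discr K ≠ -3 := discr_ne_neg_three_of_degreeOne hK h𝔭 he hf
  obtain ⟨-, -, -, -, -, htors, -⟩ := exists_frame_isTorsion_mem_charIdeal_of_goodOrd h421 W' N' K Dt'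
    hord hsurj hK hH hodd hd3 κ hκ γ 𝔭 h𝔭 he hf 𝔭' h𝔭' hne ι' hι'
  exact htors

end Summit.BirchSwinnertonDyer.BirchSwinnertonDyer.Theorems.UniversalToricDescentTwinSplit

end
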